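import Summits.QuantumFields.BalabanUV.Beta.D1BFx.TorusWeightJetsTwisted

/-!
# `BalabanUV.Beta.D1BFx.PackedCoframePairWords` — road «BF-x» for binder row D1, slot (K), chain step (I) «(A1)-PACKED», brick «COFRAME-PACK-2»,
# FILE P2: **THE TWISTED MIXED WEIGHT JET AT RESPONSE-PACKED JETS, MULTIPLIED OUT ON THE TORUS** — finite matrix algebra only: for responses
# `rS rT : ι → ℝ` on an injective family of torus bonds `b : ι → Site 4 s × Fin 4` (the road: `ι = I 3 (m+1) p`, `b = e₁ (m+1) p`) and any basis matrix `N`,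
# the packed co-frame words are `M̂_S := Σ_i rS i • Mjet₁ (b i) = J_S·D̂ᵀ − L̂·E_Sᵀ`, `M̂₂ := Σ_{ij} rS i rT j • Mjet₁₁ (b i) (b j) = J₂·D̂ᵀ − (J_S·E_Tᵀ + J_T·E_Sᵀ) + L̂·E₂ᵀ`,
# `Ĉ_S := Σ_i rS i • Cjet₁ (b i) = −Ĉ·Q_S·Ĉ`, `Ĉ₂ := Σ_{ij} rS i rT j • Cjet₁₁ (b i) (b j) = −Ĉ·Q₂·Ĉ + Ĉ·Q_S·Ĉ·Q_T·Ĉ + Ĉ·Q_T·Ĉ·Q_S·Ĉ`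
# (`E_S := Σ rS•Ê`, `E₂ := Σ rS rT•Ê` (diagonal), `J_S := Σ rS•Ljet`, `J₂ := Σ rS rT•Ljet₂`, `Q_S := J_S L̂ + L̂ J_S`, `Q₂ := J₂L̂ + J_SJ_T + J_TJ_S + L̂J₂`), and
# **`Σ_{ij} (rS i·rT j) • twgtMix s (b i) (b j) N` = the nine-term TWISTED word in these packed objects** — so that, by 3a′ `tgramMix_Tjet` + «SLOT-PACK»
# `tgramMix_packed`, the mixed co-frame slot of PART 3b's `hJN″` is ONE explicit torus expression in SIX packed words, ready for the array letters
# of P1 (`E•`, `E₂`), g22 (`J•`, `J₂`, `Q•`, `Q₂`) and N1 (`D̂·perT(arr ·)·D̂ᵀ`)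

HONEST DEPENDENCY (cell records, verbatim): «continuum YM on T⁴ ⇐ BetaPertH ∧ nine spine estimates (0/9 proved); BetaPertH ⇐ (D1) ∧ (D4) ∧
CAP+tail; G-an2-4 gates asym, D1 and NE2/3/4.»  HONEST FRAMING (cell contract, verbatim): «discharging `BetaPertH` makes Bałaban's UV stability
UNCONDITIONAL — a real constructive-QFT result; it is NOT the continuum limit and NOT the Clay problem.»  THIS MODULE DISCHARGES NOTHING of (K),
of D1 or of the wall: [folklore] finite sums of matrices over 3a `TorusWeightJetsCombFree` (`Cjet₁`, `Cjet₁₁`, `Lsq₁`, `Lsq₁₁`), 3a′ `TorusWeightJetsTwisted`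
(`twgtMix`) and `TorusCoframeJets` (`Mjet₁`, `Mjet₁₁`, `Ljet₁₁_self∕_of_ne`) BY NAME.  No `def`, no `def … : Prop`, nothing cited, 0 sorry.
0∕4 binders of row D1; (K) NOT closed; NOT D1, NOT BetaPertH, NOT continuum, NOT Clay.

ABSOLUTE RULE (cell charter, verbatim): «No internally-minted statement may enter as a cited fact. Every hypothesis is either kernel-proved in this
package or a verbatim quotation of a PUBLISHED theorem with page reference. The manuscript(s) under audit are NOT citable for their own disputed
steps — they are the thing under adjudication; programme-internal (2001/route/tribunal) claims are never citable.»

CONTENT: §1 `sum_smul_Mjet₁`, `sum_smul_Lsq₁`, `sum_smul_Cjet₁`, `sum_sum_smul_Ljet₁₁`, `sum_sum_smul_Mjet₁₁`, `sum_sum_smul_Lsq₁₁'`, `sum_sum_smul_Cjet₁₁`;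
§2 **`sum_sum_smul_twgtMix`**.
Unit `b2b-balaban-beta-d1-formalise-leaf-03` (gen 23); road owner `b2b-balaban-beta-d1-p2` (W-d1p2-g18-4∕-5, journal l.40583).
-/

noncomputable section

namespace Summit.QuantumFields.BalabanUV.Beta.D1BFx.PackedCoframePairWords

open Matrix
open scoped BigOperators
open Literature.MathematicalPhysics.QuantumFieldTheory.Balaban1983to89
open Literature.MathematicalPhysics.QuantumFieldTheory.Balaban1983to89.Beta
open Summit.QuantumFields.BalabanUV.Beta.D1BFx.PeriodisedProjector (Lhat)
open Summit.QuantumFields.BalabanUV.Beta.D1BFx.TorusHodgeWeight (Dhat)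
open Summit.QuantumFields.BalabanUV.Beta.D1BFx.TorusCoframeJets (Djet Ljet Ljet₂ Ljet₁₁ Ljet₁₁_self Ljet₁₁_of_ne Mjet₀ Mjet₁ Mjet₁₁)
open Summit.QuantumFields.BalabanUV.Beta.D1BFx.TorusWeightJetsCombFree (Lsq₁ Lsq₁₁ Chat Cjet₁ Cjet₁₁)
open Summit.QuantumFields.BalabanUV.Beta.D1BFx.TorusWeightJetsTwisted (twgtMix)

variable (s : ℕ) [NeZero s] {ρ : Type*} [Fintype ρ] [DecidableEq ρ] (N : Matrix (Site 4 s) ρ ℝ)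
  {ι : Type*} [Fintype ι] [DecidableEq ι] (b : ι → Site 4 s × Fin 4) (rS rT : ι → ℝ)

/-! ## §1 The packed co-frame words -/

omit [NeZero s] [DecidableEq ι] in
/-- [folklore] **BILINEAR PACKING**: `(Σ_i r i • f i)·(Σ_j r′ j • g j) = Σ_i Σ_j (r i·r′ j) • (f i·g j)` (rectangular matrices). -/
theorem sum_smul_mul_sum_smul {α' β' γ' : Type*} [Fintype β'] (r r' : ι → ℝ) (f : ι → Matrix α' β' ℝ) (g : ι → Matrix β' γ' ℝ) :
    (∑ i, r i • f i) * (∑ j, r' j • g j) = ∑ i, ∑ j, (r i * r' j) • (f i * g j) := by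
  rw [Matrix.sum_mul]
  refine Finset.sum_congr rfl fun i _ => ?_
  rw [Matrix.mul_sum]
  refine Finset.sum_congr rfl fun j _ => ?_
  rw [Matrix.smul_mul, Matrix.mul_smul, smul_smul]

omit [NeZero s] [DecidableEq ι] in
/-- [folklore] … the same with the two packed factors in the opposite order: `(Σ_j r′ j • g j)·(Σ_i r i • f i) = Σ_i Σ_j (r i·r′ j) • (g j·f i)`. -/
theorem sum_smul_mul_sum_smul_comm {α' β' γ' : Type*} [Fintype β'] (r r' : ι → ℝ) (f : ι → Matrix β' γ' ℝ) (g : ι → Matrix α' β' ℝ) :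
    (∑ j, r' j • g j) * (∑ i, r i • f i) = ∑ i, ∑ j, (r i * r' j) • (g j * f i) := by
  rw [sum_smul_mul_sum_smul, Finset.sum_comm]
  exact Finset.sum_congr rfl fun i _ => Finset.sum_congr rfl fun j _ => by rw [mul_comm]

omit [DecidableEq ι] in
/-- [folklore] **THE PACKED FIRST CO-FRAME WORD**: `Σ_i rS i • M̂_{b i} = (Σ_i rS i • Ljet (b i))·D̂ᵀ − L̂·(Σ_i rS i • Ê_{b i})ᵀ`. -/
theorem sum_smul_Mjet₁ :
    ∑ i, rS i • Mjet₁ s (b i) = (∑ i, rS i • Ljet s (b i)) * (Dhat 4 s)ᵀ - Lhat s * (∑ i, rS i • Djet s (b i))ᵀ := by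
  simp only [Mjet₁, smul_sub, Finset.sum_sub_distrib, Matrix.sum_mul, Matrix.smul_mul, Matrix.transpose_sum, Matrix.transpose_smul,
    Matrix.mul_sum, Matrix.mul_smul]

omit [DecidableEq ι] in
/-- [folklore] **THE PACKED FIRST `L̂²`-WORD**: `Σ_i rS i • (L̂²)_{b i} = (Σ_i rS i • Ljet (b i))·L̂ + L̂·(Σ_i rS i • Ljet (b i))`. -/
theorem sum_smul_Lsq₁ : ∑ i, rS i • Lsq₁ s (b i) = (∑ i, rS i • Ljet s (b i)) * Lhat s + Lhat s * (∑ i, rS i • Ljet s (b i)) := by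
  simp only [Lsq₁, smul_add, Finset.sum_add_distrib, Matrix.sum_mul, Matrix.smul_mul, Matrix.mul_sum, Matrix.mul_smul]

omit [DecidableEq ι] in
/-- [folklore] **THE PACKED FIRST INVERSE WORD**: `Σ_i rS i • Ĉ_{b i} = −(Ĉ·(Σ_i rS i • (L̂²)_{b i})·Ĉ)`. -/
theorem sum_smul_Cjet₁ : ∑ i, rS i • Cjet₁ s (b i) N = -(Chat s N * (∑ i, rS i • Lsq₁ s (b i)) * Chat s N) := by
  simp only [Cjet₁, smul_neg, Finset.sum_neg_distrib, Matrix.sum_mul, Matrix.mul_sum, Matrix.smul_mul, Matrix.mul_smul]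

variable {b} (hb : Function.Injective b)
include hb

omit [DecidableEq ι] in
/-- [folklore] **THE PACKED MIXED `Ljet₁₁` IS DIAGONAL**: `Σ_{ij} rS i rT j • Ljet₁₁ (b i) (b j) = Σ_i (rS i·rT i) • Ljet₂ (b i)` (`b` injective). -/
theorem sum_sum_smul_Ljet₁₁ : ∑ i, ∑ j, (rS i * rT j) • Ljet₁₁ s (b i) (b j) = ∑ i, (rS i * rT i) • Ljet₂ s (b i) := by
  classical
  refine Finset.sum_congr rfl fun i _ => ?_
  rw [Finset.sum_eq_single i]
  · rw [Ljet₁₁_self]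
  · intro j _ hj
    rw [Ljet₁₁_of_ne _ _ _ (fun h => hj (hb h).symm), smul_zero]
  · intro h; exact absurd (Finset.mem_univ _) h

omit [DecidableEq ι] in
/-- [folklore] **THE PACKED DIAGONAL TIP JET**: `Σ_{ij} rS i rT j • [b i = b j]•(L̂·Ê_{b i}ᵀ) = L̂·(Σ_i (rS i·rT i) • Ê_{b i})ᵀ`. -/
theorem sum_sum_smul_ite_Lhat_Djet :
    ∑ i, ∑ j, (rS i * rT j) • (if b i = b j then Lhat s * (Djet s (b i))ᵀ else 0) = Lhat s * (∑ i, (rS i * rT i) • Djet s (b i))ᵀ := by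
  classical
  rw [Matrix.transpose_sum, Matrix.mul_sum]
  refine Finset.sum_congr rfl fun i _ => ?_
  rw [Finset.sum_eq_single i]
  · rw [if_pos rfl, Matrix.transpose_smul, Matrix.mul_smul]
  · intro j _ hj
    rw [if_neg (fun h => hj (hb h).symm), smul_zero]
  · intro h; exact absurd (Finset.mem_univ _) h

omit [DecidableEq ι] in
/-- [folklore] **THE PACKED MIXED CO-FRAME WORD**:
`Σ_{ij} rS i rT j • M̂_{b i, b j} = (Σ_i rS i rT i • Ljet₂ (b i))·D̂ᵀ − ((Σ rS•Ljet)·(Σ rT•Ê)ᵀ + (Σ rT•Ljet)·(Σ rS•Ê)ᵀ) + L̂·(Σ_i rS i rT i • Ê_{b i})ᵀ`. -/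
theorem sum_sum_smul_Mjet₁₁ :
    ∑ i, ∑ j, (rS i * rT j) • Mjet₁₁ s (b i) (b j)
      = (∑ i, (rS i * rT i) • Ljet₂ s (b i)) * (Dhat 4 s)ᵀ
        - ((∑ i, rS i • Ljet s (b i)) * (∑ j, rT j • Djet s (b j))ᵀ + (∑ j, rT j • Ljet s (b j)) * (∑ i, rS i • Djet s (b i))ᵀ)
        + Lhat s * (∑ i, (rS i * rT i) • Djet s (b i))ᵀ := by
  have h1 : ∑ i, ∑ j, (rS i * rT j) • (Ljet₁₁ s (b i) (b j) * (Dhat 4 s)ᵀ) = (∑ i, (rS i * rT i) • Ljet₂ s (b i)) * (Dhat 4 s)ᵀ := by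
    rw [← sum_sum_smul_Ljet₁₁ s rS rT hb, Matrix.sum_mul]
    refine Finset.sum_congr rfl fun i _ => ?_
    rw [Matrix.sum_mul]
    exact Finset.sum_congr rfl fun j _ => (Matrix.smul_mul _ _ _).symm
  have h2 : ∑ i, ∑ j, (rS i * rT j) • (Ljet s (b i) * (Djet s (b j))ᵀ) = (∑ i, rS i • Ljet s (b i)) * (∑ j, rT j • Djet s (b j))ᵀ := by
    rw [Matrix.transpose_sum, show (∑ j, (rT j • Djet s (b j))ᵀ) = ∑ j, rT j • (Djet s (b j))ᵀ from
      Finset.sum_congr rfl fun j _ => Matrix.transpose_smul _ _, sum_smul_mul_sum_smul]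
  have h3 : ∑ i, ∑ j, (rS i * rT j) • (Ljet s (b j) * (Djet s (b i))ᵀ) = (∑ j, rT j • Ljet s (b j)) * (∑ i, rS i • Djet s (b i))ᵀ := by
    rw [Matrix.transpose_sum, show (∑ i, (rS i • Djet s (b i))ᵀ) = ∑ i, rS i • (Djet s (b i))ᵀ from
      Finset.sum_congr rfl fun i _ => Matrix.transpose_smul _ _, sum_smul_mul_sum_smul_comm]
  have h4 := sum_sum_smul_ite_Lhat_Djet s rS rT hb
  simp only [Mjet₁₁, smul_add, smul_sub, Finset.sum_add_distrib, Finset.sum_sub_distrib, h1, h2, h3, h4]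

omit [DecidableEq ι] in
/-- [folklore] **THE PACKED `L̂²`-PAIR WORD** (g22's `sum_sum_smul_Lsq₁₁`, generic index): `Σ_{ij} rS i rT j • (L̂²)_{b i, b j} = J₂L̂ + J_SJ_T + J_TJ_S + L̂J₂`. -/
theorem sum_sum_smul_Lsq₁₁' :
    ∑ i, ∑ j, (rS i * rT j) • Lsq₁₁ s (b i) (b j)
      = (∑ i, (rS i * rT i) • Ljet₂ s (b i)) * Lhat s
        + (∑ i, rS i • Ljet s (b i)) * (∑ j, rT j • Ljet s (b j)) + (∑ j, rT j • Ljet s (b j)) * (∑ i, rS i • Ljet s (b i))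
        + Lhat s * (∑ i, (rS i * rT i) • Ljet₂ s (b i)) := by
  have h1 : ∑ i, ∑ j, (rS i * rT j) • (Ljet₁₁ s (b i) (b j) * Lhat s) = (∑ i, (rS i * rT i) • Ljet₂ s (b i)) * Lhat s := by
    rw [← sum_sum_smul_Ljet₁₁ s rS rT hb, Matrix.sum_mul]
    refine Finset.sum_congr rfl fun i _ => ?_
    rw [Matrix.sum_mul]
    exact Finset.sum_congr rfl fun j _ => (Matrix.smul_mul _ _ _).symm
  have h4 : ∑ i, ∑ j, (rS i * rT j) • (Lhat s * Ljet₁₁ s (b i) (b j)) = Lhat s * (∑ i, (rS i * rT i) • Ljet₂ s (b i)) := by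
    rw [← sum_sum_smul_Ljet₁₁ s rS rT hb, Matrix.mul_sum]
    refine Finset.sum_congr rfl fun i _ => ?_
    rw [Matrix.mul_sum]
    exact Finset.sum_congr rfl fun j _ => (Matrix.mul_smul _ _ _).symm
  have h2 : ∑ i, ∑ j, (rS i * rT j) • (Ljet s (b i) * Ljet s (b j)) = (∑ i, rS i • Ljet s (b i)) * (∑ j, rT j • Ljet s (b j)) :=
    (sum_smul_mul_sum_smul rS rT _ _).symm
  have h3 : ∑ i, ∑ j, (rS i * rT j) • (Ljet s (b j) * Ljet s (b i)) = (∑ j, rT j • Ljet s (b j)) * (∑ i, rS i • Ljet s (b i)) :=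
    (sum_smul_mul_sum_smul_comm rS rT _ _).symm
  simp only [Lsq₁₁, smul_add, Finset.sum_add_distrib, h1, h2, h3, h4]

omit [DecidableEq ι] hb in
/-- [folklore] A sandwiched bilinear packing: `Σ_{ij} (r i·r′ j) • (A·f i·B·g j·C) = A·(Σ r•f)·B·(Σ r′•g)·C`. -/
theorem sum_sum_smul_sandwich (r r' : ι → ℝ) (A B C : Matrix (Site 4 s) (Site 4 s) ℝ) (f g : ι → Matrix (Site 4 s) (Site 4 s) ℝ) :
    ∑ i, ∑ j, (r i * r' j) • (A * f i * B * g j * C) = A * (∑ i, r i • f i) * B * (∑ j, r' j • g j) * C := by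
  have e1 : A * (∑ i, r i • f i) * B = ∑ i, r i • (A * f i * B) := by
    rw [Matrix.mul_sum, Matrix.sum_mul]
    exact Finset.sum_congr rfl fun i _ => by rw [Matrix.mul_smul, Matrix.smul_mul]
  rw [e1, sum_smul_mul_sum_smul, Matrix.sum_mul]
  refine Finset.sum_congr rfl fun i _ => ?_
  rw [Matrix.sum_mul]
  exact Finset.sum_congr rfl fun j _ => by rw [Matrix.smul_mul]

omit [DecidableEq ι] hb in
/-- [folklore] **THE PACKED MIXED INVERSE WORD**:
`Σ_{ij} rS i rT j • Ĉ_{b i, b j} = −(Ĉ·Q₂·Ĉ) + Ĉ·Q_S·Ĉ·Q_T·Ĉ + Ĉ·Q_T·Ĉ·Q_S·Ĉ` with `Q₂ := Σ_{ij} rS i rT j • (L̂²)_{b i,b j}`, `Q_S := Σ rS•(L̂²)`, `Q_T`. -/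
theorem sum_sum_smul_Cjet₁₁ :
    ∑ i, ∑ j, (rS i * rT j) • Cjet₁₁ s (b i) (b j) N
      = -(Chat s N * (∑ i, ∑ j, (rS i * rT j) • Lsq₁₁ s (b i) (b j)) * Chat s N)
        + Chat s N * (∑ i, rS i • Lsq₁ s (b i)) * Chat s N * (∑ j, rT j • Lsq₁ s (b j)) * Chat s N
        + Chat s N * (∑ j, rT j • Lsq₁ s (b j)) * Chat s N * (∑ i, rS i • Lsq₁ s (b i)) * Chat s N := by
  have h1 : ∑ i, ∑ j, (rS i * rT j) • (-(Chat s N * Lsq₁₁ s (b i) (b j) * Chat s N))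
      = -(Chat s N * (∑ i, ∑ j, (rS i * rT j) • Lsq₁₁ s (b i) (b j)) * Chat s N) := by
    simp only [smul_neg, Finset.sum_neg_distrib, Matrix.mul_sum, Matrix.sum_mul, Matrix.smul_mul, Matrix.mul_smul]
  have h2 : ∑ i, ∑ j, (rS i * rT j) • (Chat s N * Lsq₁ s (b i) * Chat s N * Lsq₁ s (b j) * Chat s N)
      = Chat s N * (∑ i, rS i • Lsq₁ s (b i)) * Chat s N * (∑ j, rT j • Lsq₁ s (b j)) * Chat s N :=
    sum_sum_smul_sandwich s rS rT _ _ _ _ _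
  have h3 : ∑ i, ∑ j, (rS i * rT j) • (Chat s N * Lsq₁ s (b j) * Chat s N * Lsq₁ s (b i) * Chat s N)
      = Chat s N * (∑ j, rT j • Lsq₁ s (b j)) * Chat s N * (∑ i, rS i • Lsq₁ s (b i)) * Chat s N := by
    rw [← sum_sum_smul_sandwich s rT rS, Finset.sum_comm]
    exact Finset.sum_congr rfl fun i _ => Finset.sum_congr rfl fun j _ => by rw [mul_comm]
  simp only [Cjet₁₁, smul_add, Finset.sum_add_distrib, h1, h2, h3]

/-! ## §2 The twisted mixed weight jet at packed jets, multiplied out -/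

omit [DecidableEq ι] hb in
/-- [folklore] `Σ_{ij} (r i·r′ j) • ((f i)ᵀ·B j·C) = (Σ r•f)ᵀ·(Σ r′•B)·C`. -/
theorem sum_sum_smul_tmul {α' : Type*} (r r' : ι → ℝ) (f : ι → Matrix (Site 4 s) α' ℝ) (B : ι → Matrix (Site 4 s) (Site 4 s) ℝ)
    (C : Matrix (Site 4 s) α' ℝ) :
    ∑ i, ∑ j, (r i * r' j) • ((f i)ᵀ * B j * C) = (∑ i, r i • f i)ᵀ * (∑ j, r' j • B j) * C := by
  rw [Matrix.transpose_sum, show (∑ i, (r i • f i)ᵀ) = ∑ i, r i • (f i)ᵀ from Finset.sum_congr rfl fun i _ => Matrix.transpose_smul _ _,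
    sum_smul_mul_sum_smul, Matrix.sum_mul]
  refine Finset.sum_congr rfl fun i _ => ?_
  rw [Matrix.sum_mul]
  exact Finset.sum_congr rfl fun j _ => by rw [Matrix.smul_mul]

omit [DecidableEq ι] hb in
/-- [folklore] `Σ_{ij} (r i·r′ j) • ((f j)ᵀ·B i·C) = (Σ r′•f)ᵀ·(Σ r•B)·C` (the swapped pairing). -/
theorem sum_sum_smul_tmul_comm {α' : Type*} (r r' : ι → ℝ) (f : ι → Matrix (Site 4 s) α' ℝ) (B : ι → Matrix (Site 4 s) (Site 4 s) ℝ)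
    (C : Matrix (Site 4 s) α' ℝ) :
    ∑ i, ∑ j, (r i * r' j) • ((f j)ᵀ * B i * C) = (∑ j, r' j • f j)ᵀ * (∑ i, r i • B i) * C := by
  rw [← sum_sum_smul_tmul, Finset.sum_comm]
  exact Finset.sum_congr rfl fun i _ => Finset.sum_congr rfl fun j _ => by rw [mul_comm]

omit [DecidableEq ι] hb in
/-- [folklore] `Σ_{ij} (r i·r′ j) • (A·B i·g j) = A·(Σ r•B)·(Σ r′•g)`. -/
theorem sum_sum_smul_lmul {α' : Type*} (r r' : ι → ℝ) (A : Matrix α' (Site 4 s) ℝ) (B : ι → Matrix (Site 4 s) (Site 4 s) ℝ)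
    (g : ι → Matrix (Site 4 s) α' ℝ) :
    ∑ i, ∑ j, (r i * r' j) • (A * B i * g j) = A * (∑ i, r i • B i) * (∑ j, r' j • g j) := by
  have e1 : A * (∑ i, r i • B i) = ∑ i, r i • (A * B i) := by
    rw [Matrix.mul_sum]
    exact Finset.sum_congr rfl fun i _ => by rw [Matrix.mul_smul]
  rw [e1, sum_smul_mul_sum_smul]

omit [DecidableEq ι] hb in
/-- [folklore] `Σ_{ij} (r i·r′ j) • (A·B j·g i) = A·(Σ r′•B)·(Σ r•g)` (swapped). -/
theorem sum_sum_smul_lmul_comm {α' : Type*} (r r' : ι → ℝ) (A : Matrix α' (Site 4 s) ℝ) (B : ι → Matrix (Site 4 s) (Site 4 s) ℝ)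
    (g : ι → Matrix (Site 4 s) α' ℝ) :
    ∑ i, ∑ j, (r i * r' j) • (A * B j * g i) = A * (∑ j, r' j • B j) * (∑ i, r i • g i) := by
  rw [← sum_sum_smul_lmul, Finset.sum_comm]
  exact Finset.sum_congr rfl fun i _ => Finset.sum_congr rfl fun j _ => by rw [mul_comm]

omit [DecidableEq ι] hb in
/-- [folklore] `Σ_{ij} (r i·r′ j) • ((f i)ᵀ·B·g j) = (Σ r•f)ᵀ·B·(Σ r′•g)`. -/
theorem sum_sum_smul_tmul₂ {α' : Type*} (r r' : ι → ℝ) (f g : ι → Matrix (Site 4 s) α' ℝ) (B : Matrix (Site 4 s) (Site 4 s) ℝ) :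
    ∑ i, ∑ j, (r i * r' j) • ((f i)ᵀ * B * g j) = (∑ i, r i • f i)ᵀ * B * (∑ j, r' j • g j) := by
  rw [Matrix.transpose_sum, Matrix.sum_mul,
    show (∑ i, (r i • f i)ᵀ * B) = ∑ i, r i • ((f i)ᵀ * B) from Finset.sum_congr rfl fun i _ => by rw [Matrix.transpose_smul, Matrix.smul_mul],
    sum_smul_mul_sum_smul]

omit [DecidableEq ι] hb in
/-- [folklore] … swapped: `Σ_{ij} (r i·r′ j) • ((f j)ᵀ·B·g i) = (Σ r′•f)ᵀ·B·(Σ r•g)`. -/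
theorem sum_sum_smul_tmul₂_comm {α' : Type*} (r r' : ι → ℝ) (f g : ι → Matrix (Site 4 s) α' ℝ) (B : Matrix (Site 4 s) (Site 4 s) ℝ) :
    ∑ i, ∑ j, (r i * r' j) • ((f j)ᵀ * B * g i) = (∑ j, r' j • f j)ᵀ * B * (∑ i, r i • g i) := by
  rw [← sum_sum_smul_tmul₂, Finset.sum_comm]
  exact Finset.sum_congr rfl fun i _ => Finset.sum_congr rfl fun j _ => by rw [mul_comm]

omit [DecidableEq ι] hb in
/-- [folklore] **THE TWISTED MIXED WEIGHT JET AT RESPONSE-PACKED JETS**: with `M̂_S := Σ_i rS i • Mjet₁ (b i)`, `M̂_T`, `M̂₂ := Σ_{ij} rS i rT j • Mjet₁₁ (b i) (b j)`,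
`Ĉ_S := Σ_i rS i • Cjet₁ (b i)`, `Ĉ_T`, `Ĉ₂ := Σ_{ij} rS i rT j • Cjet₁₁ (b i) (b j)`:
`Σ_{ij} (rS i·rT j) • twgtMix s (b i) (b j) N = M̂₂ᵀĈM̂₀ − M̂_SᵀĈ_TM̂₀ − M̂_TᵀĈ_SM̂₀ + M̂₀ᵀĈ₂M̂₀ − M̂_SᵀĈM̂_T − M̂_TᵀĈM̂_S + M̂₀ᵀĈ_SM̂_T + M̂₀ᵀĈ_TM̂_S + M̂₀ᵀĈM̂₂`. -/
theorem sum_sum_smul_twgtMix :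
    ∑ i, ∑ j, (rS i * rT j) • twgtMix s (b i) (b j) N
      = (∑ i, ∑ j, (rS i * rT j) • Mjet₁₁ s (b i) (b j))ᵀ * Chat s N * Mjet₀ s
        + -((∑ i, rS i • Mjet₁ s (b i))ᵀ * (∑ j, rT j • Cjet₁ s (b j) N) * Mjet₀ s)
        + -((∑ j, rT j • Mjet₁ s (b j))ᵀ * (∑ i, rS i • Cjet₁ s (b i) N) * Mjet₀ s)
        + (Mjet₀ s)ᵀ * (∑ i, ∑ j, (rS i * rT j) • Cjet₁₁ s (b i) (b j) N) * Mjet₀ s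
        + -((∑ i, rS i • Mjet₁ s (b i))ᵀ * Chat s N * (∑ j, rT j • Mjet₁ s (b j)))
        + -((∑ j, rT j • Mjet₁ s (b j))ᵀ * Chat s N * (∑ i, rS i • Mjet₁ s (b i)))
        + (Mjet₀ s)ᵀ * (∑ i, rS i • Cjet₁ s (b i) N) * (∑ j, rT j • Mjet₁ s (b j))
        + (Mjet₀ s)ᵀ * (∑ j, rT j • Cjet₁ s (b j) N) * (∑ i, rS i • Mjet₁ s (b i))
        + (Mjet₀ s)ᵀ * Chat s N * (∑ i, ∑ j, (rS i * rT j) • Mjet₁₁ s (b i) (b j)) := by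
  have t1 : ∑ i, ∑ j, (rS i * rT j) • ((Mjet₁₁ s (b i) (b j))ᵀ * Chat s N * Mjet₀ s)
      = (∑ i, ∑ j, (rS i * rT j) • Mjet₁₁ s (b i) (b j))ᵀ * Chat s N * Mjet₀ s := by
    rw [Matrix.transpose_sum, Matrix.sum_mul, Matrix.sum_mul]
    refine Finset.sum_congr rfl fun i _ => ?_
    rw [Matrix.transpose_sum, Matrix.sum_mul, Matrix.sum_mul]
    exact Finset.sum_congr rfl fun j _ => by rw [Matrix.transpose_smul, Matrix.smul_mul, Matrix.smul_mul]
  have t9 : ∑ i, ∑ j, (rS i * rT j) • ((Mjet₀ s)ᵀ * Chat s N * Mjet₁₁ s (b i) (b j))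
      = (Mjet₀ s)ᵀ * Chat s N * (∑ i, ∑ j, (rS i * rT j) • Mjet₁₁ s (b i) (b j)) := by
    rw [Matrix.mul_sum]
    refine Finset.sum_congr rfl fun i _ => ?_
    rw [Matrix.mul_sum]
    exact Finset.sum_congr rfl fun j _ => by rw [Matrix.mul_smul]
  have t4 : ∑ i, ∑ j, (rS i * rT j) • ((Mjet₀ s)ᵀ * Cjet₁₁ s (b i) (b j) N * Mjet₀ s)
      = (Mjet₀ s)ᵀ * (∑ i, ∑ j, (rS i * rT j) • Cjet₁₁ s (b i) (b j) N) * Mjet₀ s := by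
    rw [Matrix.mul_sum, Matrix.sum_mul]
    refine Finset.sum_congr rfl fun i _ => ?_
    rw [Matrix.mul_sum, Matrix.sum_mul]
    exact Finset.sum_congr rfl fun j _ => by rw [Matrix.mul_smul, Matrix.smul_mul]
  have t2 := sum_sum_smul_tmul s rS rT (fun i => Mjet₁ s (b i)) (fun j => Cjet₁ s (b j) N) (Mjet₀ s)
  have t3 := sum_sum_smul_tmul_comm s rS rT (fun j => Mjet₁ s (b j)) (fun i => Cjet₁ s (b i) N) (Mjet₀ s)
  have t5 := sum_sum_smul_tmul₂ s rS rT (fun i => Mjet₁ s (b i)) (fun j => Mjet₁ s (b j)) (Chat s N)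
  have t6 := sum_sum_smul_tmul₂_comm s rS rT (fun j => Mjet₁ s (b j)) (fun i => Mjet₁ s (b i)) (Chat s N)
  have t7 := sum_sum_smul_lmul s rS rT (Mjet₀ s)ᵀ (fun i => Cjet₁ s (b i) N) (fun j => Mjet₁ s (b j))
  have t8 := sum_sum_smul_lmul_comm s rS rT (Mjet₀ s)ᵀ (fun j => Cjet₁ s (b j) N) (fun i => Mjet₁ s (b i))
  simp only [twgtMix, smul_add, smul_neg, Finset.sum_add_distrib, Finset.sum_neg_distrib, t1, t2, t3, t4, t5, t6, t7, t8, t9]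

end Summit.QuantumFields.BalabanUV.Beta.D1BFx.PackedCoframePairWords

end
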